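import Literature.MathematicalPhysics.QuantumFieldTheory.Balaban1983to89.B9Eq3126EnergyBallTowerClosed
import Literature.MathematicalPhysics.QuantumFieldTheory.Balaban1983to89.B11Eq117LetterDefects

/-!
# `Balaban1983to89.B11Eq117LetterDefectsTowerDiagonal` — T. Bałaban, *The variational problem and background fields in renormalization group method
# for lattice gauge theories*, Commun. Math. Phys. **102** (1985) 277–309 [Balaban1985Variational] (115)∕(117) pp. 294–295 with T. Bałaban, *Propagators
# for lattice gauge theories in a background field*, Commun. Math. Phys. **99** (1985) 389–434 [Balaban1985BackgroundPropagators] Thm 3.4 p. 400, (3.126)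
# p. 420, (3.153) p. 426: THE `k`-LEVEL CHART LETTERS `𝔊_k(U)`, `H_k(U)` READ ACROSS THE TWO (115) NORMS ON PRINT's DIAGONAL — the letter defects
# `K_ι`, `δ_G`, `δ_A` of `B11Eq117LetterDefects` ONE STOREY UP, with the `L²` Lipschitz letters LEVEL-FREE (the energy junction
# `B9Eq3126EnergyBallTowerClosed`) and (117)'s finite-lattice factor DISPLAYED as the one remaining product; `∃ α₀ K` BEFORE EVERY BINDER

statement-level skeleton of published theorems with citation tags; proofs where landed; nothing here is a claim about the Yang–Mills mass gap

CITATION HEADER (lean-in-tree rule).  Audit cell `pub-balaban`, sub-cell `t4`, BINDER row NE9; filed by the row OWNER lineage `b2b-balaban-t4-ne9-p1`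
(gen 87; plan v6 (b2) «the chart consumer's currency», second file).  Sources READ by this lineage in the held texts: [Balaban1985Variational] pp. 285,
293–295, 305 (`paper:balaban1985-cmp102-variational-background`, journal page = PDF page + 276); [Balaban1985BackgroundPropagators] pp. 391, 400, 420, 426
(`paper:balaban1985-cmp99-background-propagators`, journal page = PDF page + 388).

THE PRINT (verbatim).  [Balaban1985Variational] p. 295 L7–L9: *«By Theorem 3.13 of [5] the norm max{| |_(−1), |∇ |_(−2)} of the transformation can be
estimated by [(117)] if ε₄ + B₀|B| ≤ a₃»*; [Balaban1985BackgroundPropagators] p. 400, Thm 3.4: *«G(U) is an analytic function of U′ on the space of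
configurations U′ satisfying (3.35)»* — read in the cell at a fixed lattice as Lipschitz continuity of the letters in `U` at the flat point, here at
`k = n+1` averaging levels and in the ENERGY currency.

WHY THIS FILE (cell context).  `B11Eq117LetterDefects.exists_letter_defects_at_flat` (this lineage, gen 82) PRODUCES the three inputs `K_ι`, `δ_G`, `δ_A` of
`B11Eq120SolutionContinuity` ∕ `B11Eq174ChartContinuityAtFlat` (the chart of `cur U` against the flat chart) for the ONE-STEP operator from the operator-norm
Lipschitz letters `B9Eq386LipschitzH1` ∕ `B9Eq3153FrakGLipschitz`, whose constants carry `‖Δ_a(U) − Δ_a(1)‖ ∝ |η|⁻²` (D-ne9p1-g86-2).  For print's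
`k`-th-step operator the energy junction `B9Eq3126EnergyBallTowerClosed.exists_energy_ball_diagonal_closed` gives `‖𝔊_k(U)x − 𝔊_k(1)x‖ ≤ Cα‖x‖`,
`‖H_k(U)b − H_k(1)b‖ ≤ Cα‖b‖` with `C` LEVEL-FREE on the diagonal; this file reads them across the two (115) norms exactly as gen 82 did, so that the
`k`-level chart-continuity chain ((B″)∕(Z) one storey up) has its three inputs with the residual non-uniformity isolated in (117)'s explicit product.

WHAT IS PROVED (sorry-free; no `def`, no `Prop` placeholder; no inequality of the paper asserted hypothesis-free).
* **`exists_letter_defects_tower_diagonal_closed`** — there are `α₀, K > 0` (`K` closed in `(d, a, L, M_φ, M_φ′, r, C_τ, ρ_w)`) such that for every `n`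
  (`3 ≤ L^{n+1}`), `η > 0` (`ηL^{n+1} = 1`), `c₀, c₁` (`c₀(L^{n+1})^d = c₁`, `|η|^d∕c₀ ≤ ρ_w`), `m`, ANY level maps `lev₀, lev_B, lev₁`, every background `U`
  of E162's data which is unitary, `U(b) ∈ U1`, in the windows `‖U(b) − 1‖ ≤ αη`, `‖U(∂p) − 1‖ ≤ αη²`, `‖Ū^j(b) − 1‖ ≤ ε_j ≤ αr^j` (`0 ≤ α ≤ α₀`), and ANY
  witnesses `hposU hpos1 hQU hQ1`, with `ι = ι_{∇_U → ∇_1}` the jet identity: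
  (K_ι) `‖ι f‖ ≤ (1 + w̄₁·(2|η|⁻¹·αη)·w̲₀⁻¹)‖f‖` (the bond window enters as `2|η|⁻¹·αη` — level-free `2α` on the diagonal up to the weights);
  (δ_G) `‖ι(𝔊_k(U)f) − 𝔊_k(1)f‖_(115),∇_1 ≤ K·V_G·α·|f|_(−3)`; (δ_A) `‖ι(H_k(U)B) − H_k(1)B‖_(115),∇_1 ≤ K·V_H·α·|B|_(−0)`, with the (117) products
  `V_G = max(w̄₀, w̄₁·2|η|⁻¹)·(M_φ√(c₀#β_k)M_φ′∕√c₀)·w̲₃⁻¹`, `V_H = max(w̄₀, w̄₁·2|η|⁻¹)·(M_φ√(c₁#β_m)M_φ′∕√c₀)·w̲_B⁻¹` DISPLAYED verbatim.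
  MECHANISM: the junction's mass rows of the two Lipschitz groups; `B11Eq117LetterDefects` §1–§3 (`norm_jetId_le`, `norm_toCLM115_readFun_sub_le`,
  `norm_H1CLM_sub_le`, `jetId_frakG_eq_toCLM115_readFun`, `frakG_eq_toCLM115_readFun`) with `‖∇_1‖ ≤ 2|η|⁻¹` and `‖∇_1 − ∇_U‖ ≤ 2|η|⁻¹·αη`
  (`norm_nabla115_le`, `norm_nabla115_sub_flat_le`).
HONEST SCOPE.  [folklore] composition by name; the (117) factors ARE load-bearing finite-lattice numbers (level AND volume) — NOT print's lattice-uniform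
`B₀` (Thm 3.13's decay); FIRST order at the flat point only (no two general backgrounds, no analyticity in `U`); the small-field WINDOWS, E162's data,
unitarity + the trace letters, `ρ_w` and the witnesses stay HYPOTHESES.  NOT summit progress (cell pub-balaban: NE9 NOT PRINTED ∕ NOT PROVED; «NE9 ⇐ the
named binders»; row WALLED ON A MODEL (O-NE9-1; #5 UNRULED); spine PROVED 0∕9; rung (B)+1 finite T⁴ — NOT infinite volume, NOT mass gap, NOT BetaPertH, NOT
Clay).  HONEST DEPENDENCY (cell line): continuum YM on T⁴ ⇐ BetaPertH ∧ nine spine estimates (0/9 proved); BetaPertH ⇐ (D1) ∧ (D4) ∧ CAP+tail; G-an2-4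
gates asym, D1 and NE2/3/4.  NEW file; nothing modified.  Net new unproved facts: 0.
-/

noncomputable section

open scoped InnerProductSpace ComplexConjugate BigOperators

namespace Literature.MathematicalPhysics.QuantumFieldTheory.Balaban1983to89.B11Eq117LetterDefectsTowerDiagonal

open B4Sect5Torus (TSite)
open B9SectCLatticeCarrier (Bond)
open B11Eq103H1Complex (SiteL2K BondL2K covDerivL2K covDivL2K laplaceALatticeK greenK G1LatticeK H1LatticeK frakGLatticeK KinvLatticeK
  H1LatticeCLM frakGLatticeCLM H1CLM readFun)
open B11Eq115Space (NegSize Space115 levWeight NegSup)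
open B11Eq111FrakG (nabla115 jetLinearEquiv toCLM115)
open B11Eq117TransformationNorm (norm_nabla115_le)
open B11Eq117LetterDefects (norm_jetId_le norm_nabla115_sub_flat_le norm_toCLM115_readFun_sub_le norm_H1CLM_sub_le
  jetId_frakG_eq_toCLM115_readFun frakG_eq_toCLM115_readFun)
open B9Eq310HessianOperator (adTransportW hessOp covCurlL2K)
open B9Eq310DeltaPrime (plaqHolU)
open B9Eq315QTorus (perCfg cornerSite)
open B9Eq315QTower (towerP UlevOf)
open B9Eq315QTowerFlat (perCfg_UlevOf_one_mem_U1 norm_Wcx_UlevOf_one_sub_one_le)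
open B9Eq326OperatorTower (laplaceAk QkW RofUk)
open B7Prop1Explicit (U1 Wcx boxVec)
open B9Eq3126EnergyBallTowerClosed (exists_energy_ball_diagonal_closed)

variable {d : ℕ} (hd : 1 ≤ d) (L : ℕ) [NeZero L] (hL : 1 ≤ L)
  {𝔸 : Type*} [NormedRing 𝔸] [NormedAlgebra ℂ 𝔸] [CompleteSpace 𝔸] [NormOneClass 𝔸] [StarRing 𝔸] [NormedStarGroup 𝔸] [StarModule ℂ 𝔸]
  [FiniteDimensional ℂ 𝔸]
  {W : Type*} [NormedAddCommGroup W] [InnerProductSpace ℂ W] [FiniteDimensional ℂ W] (φ : W ≃ₗ[ℂ] 𝔸)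
  {Mφ Mφ' : ℝ} (hMφ : 0 ≤ Mφ) (hMφ' : 0 ≤ Mφ') (hφ : ∀ w, ‖φ w‖ ≤ Mφ * ‖w‖) (hφ' : ∀ X, ‖φ.symm X‖ ≤ Mφ' * ‖X‖)
  {a : ℝ} (ha : 0 < a) {r : ℝ} (hr0 : 0 ≤ r) (hr1 : r < 1)
  (τ : 𝔸 →ₗ[ℂ] ℂ) {Cτ : ℝ} (hτ : ∀ X, ‖τ X‖ ≤ Cτ * ‖X‖) (hCτ : 0 ≤ Cτ) {ρw : ℝ} (hρw : 0 ≤ ρw)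
  (hτ₁ : ∀ X : 𝔸, τ (star X) = conj (τ X)) (hτ₂ : ∀ X Y : 𝔸, τ (X * Y) = τ (Y * X))
  (hφτ : ∀ X Y : 𝔸, ⟪φ.symm X, φ.symm Y⟫_ℂ = τ (star X * Y))

include hd hMφ hMφ' hφ hφ' ha hr0 hr1 hτ hCτ hρw hτ₁ hτ₂ hφτ

set_option maxHeartbeats 800000 in
set_option maxRecDepth 8192 in
/-- **THE `k`-LEVEL LETTER DEFECTS AT THE FLAT POINT ON THE DIAGONAL, (117)'s FACTOR ISOLATED** — see the module header: `∃ α₀ K > 0` (`K` level-free)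
before every binder; then for unitary `U` in the three windows, ANY level maps and ANY witnesses: (K_ι) the jet identity `∇_U → ∇_1` is bounded by
`1 + w̄₁·(2|η|⁻¹·αη)·w̲₀⁻¹`; (δ_G) `‖ι(𝔊_k(U)f) − 𝔊_k(1)f‖ ≤ K·V_G·α·‖f‖`; (δ_A) `‖ι(H_k(U)B) − H_k(1)B‖ ≤ K·V_H·α·‖B‖`, the (117) products `V_G`, `V_H`
displayed.  The energy junction read through `B11Eq117LetterDefects` §1–§3. [folklore]
[cite: Balaban1985Variational, (103) p.293, (110)–(111) p.294, (115) p.294, (117) p.295, (174) p.305; Balaban1985BackgroundPropagators, (3.3) p.391, Thm 3.4 p.400, (3.126) p.420, (3.153) p.426] -/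
theorem exists_letter_defects_tower_diagonal_closed [Fact (0 < (L : ℝ))] :
    ∃ α₀ K : ℝ, 0 < α₀ ∧ 0 < K ∧ ∀ (n : ℕ) (η : ℝ) [Fact (0 < η)], η * (L : ℝ) ^ (n + 1) = 1 → 3 ≤ L ^ (n + 1) →
      ∀ (c₀ c₁ : ℝ) [Fact (0 < c₀)] [Fact (0 < c₁)], c₀ * ((L : ℝ) ^ (n + 1)) ^ d = c₁ → |η| ^ d / c₀ ≤ ρw →
      ∀ (m : Fin d → ℕ) [∀ i, NeZero (m i)] (lev₀ : Bond d (towerP L m (n + 1)) → ℕ) (levB : Bond d m → ℕ)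
        (lev₁ : Bond d (towerP L m (n + 1)) × Fin d → ℕ)
        (U : Bond d (towerP L m (n + 1)) → 𝔸ˣ) (αU : ℕ → ℝ) (hα1 : ∀ j, αU j ≤ 1 / 64)
        (hU1 : ∀ (j : ℕ) (x : B7Prop1Explicit.Site d) (κ : Fin d), perCfg (towerP L m (j + 1)) (UlevOf L m (n + 1) U j) x κ ∈ U1 𝔸)
        (hreg : ∀ (j : ℕ) (y : TSite d (towerP L m j)) (κ : Fin d) (r : Fin d → Fin L),
          ‖((Wcx L (perCfg (towerP L m (j + 1)) (UlevOf L m (n + 1) U j)) (cornerSite L y) κ (boxVec L r) : 𝔸ˣ) : 𝔸) - 1‖ ≤ αU j)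
        (εU : ℕ → ℝ), (∀ j, 0 ≤ εU j) → (∀ (j : ℕ) (b : Bond d (towerP L m (j + 1))), ‖(UlevOf L m (n + 1) U j b : 𝔸) - 1‖ ≤ εU j) →
      ∀ {α : ℝ}, 0 ≤ α → α ≤ α₀ →
        (∀ b, star (U b : 𝔸) = (((U b)⁻¹ : 𝔸ˣ) : 𝔸)) →
        (∀ b, U b ∈ U1 𝔸) → (∀ b, ‖(U b : 𝔸) - 1‖ ≤ α * η) →
        (∀ p : B9SectCLatticeCarrier.Plaq d (towerP L m (n + 1)), ‖(plaqHolU U p : 𝔸) - 1‖ ≤ α * η ^ 2) →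
        (∀ j < n + 1, εU j ≤ α * r ^ j) →
        ∀ (hposU : ∀ x : BondL2K ℂ d (towerP L m (n + 1)) c₀ W, x ≠ 0 →
            0 < RCLike.re ⟪x, laplaceAk L m n φ η U hL αU hα1 hU1 hreg τ (c₀ := c₀) (c₁ := c₁) a x⟫_ℂ)
          (hpos1 : ∀ x : BondL2K ℂ d (towerP L m (n + 1)) c₀ W, x ≠ 0 →
            0 < RCLike.re ⟪x, laplaceAk L m n φ η (fun _ : Bond d (towerP L m (n + 1)) => (1 : 𝔸ˣ)) hL (fun _ => 0) (fun _ => by norm_num)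
              (perCfg_UlevOf_one_mem_U1 L m (n + 1)) (norm_Wcx_UlevOf_one_sub_one_le L m (n + 1) (fun _ => 0) (fun _ => le_rfl)) τ
              (c₀ := c₀) (c₁ := c₁) a x⟫_ℂ)
          (hQU : Function.Surjective (QkW L m n φ U hL αU hα1 hU1 hreg (c₀ := c₀) (c₁ := c₁)))
          (hQ1 : Function.Surjective (QkW L m n φ (fun _ : Bond d (towerP L m (n + 1)) => (1 : 𝔸ˣ)) hL (fun _ => 0) (fun _ => by norm_num)
            (perCfg_UlevOf_one_mem_U1 L m (n + 1)) (norm_Wcx_UlevOf_one_sub_one_le L m (n + 1) (fun _ => 0) (fun _ => le_rfl)) (c₀ := c₀) (c₁ := c₁))),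
        -- (K_ι) the jet identity `∇_U → ∇_1`
        (∀ f : Space115 (L : ℝ) η lev₀ lev₁ (nabla115 η U),
          ‖LinearMap.toContinuousLinearMap
              ((jetLinearEquiv (L : ℝ) η lev₀ lev₁ (nabla115 η (fun _ : Bond d (towerP L m (n + 1)) => (1 : 𝔸ˣ)))).symm.toLinearMap ∘ₗ
                (jetLinearEquiv (L : ℝ) η lev₀ lev₁ (nabla115 η U)).toLinearMap) f‖ ≤
            (1 + (NegSup.wSup (levWeight (L : ℝ) η lev₁ 2) : ℝ) * (2 * ‖((η : ℂ))⁻¹‖ * (α * η)) * NegSup.wInvSup (levWeight (L : ℝ) η lev₀ 1)) * ‖f‖) ∧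
        -- (δ_G) the `𝔊`-letter across the two norms
        (∀ f : NegSize (L : ℝ) η lev₀ 3 𝔸,
          ‖LinearMap.toContinuousLinearMap
              ((jetLinearEquiv (L : ℝ) η lev₀ lev₁ (nabla115 η (fun _ : Bond d (towerP L m (n + 1)) => (1 : 𝔸ˣ)))).symm.toLinearMap ∘ₗ
                (jetLinearEquiv (L : ℝ) η lev₀ lev₁ (nabla115 η U)).toLinearMap)
              (frakGLatticeCLM (L := (L : ℝ)) (η := η) (lev₀ := lev₀) φ hposU hQU lev₁ (nabla115 η U) f) -
            frakGLatticeCLM (L := (L : ℝ)) (η := η) (lev₀ := lev₀) (c := ((η : ℂ))⁻¹) (R := adTransportW φ (fun _ : Bond d (towerP L m (n + 1)) => (1 : 𝔸ˣ)))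
              (S := adTransportW φ fun _ : Bond d (towerP L m (n + 1)) => (1 : 𝔸ˣ)⁻¹) (Δ₁ := hessOp φ η (fun _ : Bond d (towerP L m (n + 1)) => (1 : 𝔸ˣ)) τ)
              (Rr := RofUk L m n φ η (fun _ : Bond d (towerP L m (n + 1)) => (1 : 𝔸ˣ)))
              (Q := (QkW L m n φ (fun _ : Bond d (towerP L m (n + 1)) => (1 : 𝔸ˣ)) hL (fun _ => 0) (fun _ => by norm_num)
                (perCfg_UlevOf_one_mem_U1 L m (n + 1)) (norm_Wcx_UlevOf_one_sub_one_le L m (n + 1) (fun _ => 0) (fun _ => le_rfl)) (c₀ := c₀) (c₁ := c₁)))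
              (a := a) φ hpos1 hQ1 lev₁ (nabla115 η fun _ : Bond d (towerP L m (n + 1)) => (1 : 𝔸ˣ)) f‖ ≤
            K * (max (NegSup.wSup (levWeight (L : ℝ) η lev₀ 1) : ℝ) (NegSup.wSup (levWeight (L : ℝ) η lev₁ 2) * (2 * ‖((η : ℂ))⁻¹‖)) *
              (Mφ * Real.sqrt (c₀ * Fintype.card (Bond d (towerP L m (n + 1)))) * Mφ' / Real.sqrt c₀) *
              NegSup.wInvSup (levWeight (L : ℝ) η lev₀ 3)) * α * ‖f‖) ∧
        -- (δ_A) the `H₁`-letter across the two norms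
        (∀ B : NegSize (L : ℝ) η levB 0 𝔸,
          ‖LinearMap.toContinuousLinearMap
              ((jetLinearEquiv (L : ℝ) η lev₀ lev₁ (nabla115 η (fun _ : Bond d (towerP L m (n + 1)) => (1 : 𝔸ˣ)))).symm.toLinearMap ∘ₗ
                (jetLinearEquiv (L : ℝ) η lev₀ lev₁ (nabla115 η U)).toLinearMap)
              (H1LatticeCLM (L := (L : ℝ)) (η := η) (lev₀ := lev₀) (levB := levB) φ hposU hQU lev₁ (nabla115 η U) B) -
            H1LatticeCLM (L := (L : ℝ)) (η := η) (lev₀ := lev₀) (levB := levB) (c := ((η : ℂ))⁻¹)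
              (R := adTransportW φ (fun _ : Bond d (towerP L m (n + 1)) => (1 : 𝔸ˣ)))
              (S := adTransportW φ fun _ : Bond d (towerP L m (n + 1)) => (1 : 𝔸ˣ)⁻¹) (Δ₁ := hessOp φ η (fun _ : Bond d (towerP L m (n + 1)) => (1 : 𝔸ˣ)) τ)
              (Rr := RofUk L m n φ η (fun _ : Bond d (towerP L m (n + 1)) => (1 : 𝔸ˣ)))
              (Q := (QkW L m n φ (fun _ : Bond d (towerP L m (n + 1)) => (1 : 𝔸ˣ)) hL (fun _ => 0) (fun _ => by norm_num)
                (perCfg_UlevOf_one_mem_U1 L m (n + 1)) (norm_Wcx_UlevOf_one_sub_one_le L m (n + 1) (fun _ => 0) (fun _ => le_rfl)) (c₀ := c₀) (c₁ := c₁)))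
              (a := a) φ hpos1 hQ1 lev₁ (nabla115 η fun _ : Bond d (towerP L m (n + 1)) => (1 : 𝔸ˣ)) B‖ ≤
            K * (max (NegSup.wSup (levWeight (L : ℝ) η lev₀ 1) : ℝ) (NegSup.wSup (levWeight (L : ℝ) η lev₁ 2) * (2 * ‖((η : ℂ))⁻¹‖)) *
              (Mφ * Real.sqrt (c₁ * Fintype.card (Bond d m)) * Mφ' / Real.sqrt c₀) *
              NegSup.wInvSup (levWeight (L : ℝ) η levB 0)) * α * ‖B‖) := by
  obtain ⟨α₀, C, hα₀, hC, H⟩ := exists_energy_ball_diagonal_closed hd L hL φ hMφ hMφ' hφ hφ' ha hr0 hr1 τ hτ hCτ hρw hτ₁ hτ₂ hφτ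
  refine ⟨α₀, C, hα₀, hC, ?_⟩
  intro n η _ hηL hL3 c₀ c₁ _ _ hw hρ m _ lev₀ levB lev₁ U αU hα1 hU1 hreg εU hεU hUε α hα0 hαle hUst hUb hUη hpl hεg hposU hpos1 hQU hQ1
  obtain ⟨-, -, HF, HH⟩ := H n η hηL hL3 c₀ c₁ hw hρ m U αU hα1 hU1 hreg εU hεU hUε hα0 hαle hUst hUb hUη hpl hεg hposU hpos1 hQU hQ1
  -- the mass rows of the two Lipschitz groups
  have hG : ∀ x : BondL2K ℂ d (towerP L m (n + 1)) c₀ W, ‖frakGLatticeK hposU hQU x - frakGLatticeK (c := ((η : ℂ))⁻¹)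
        (R := adTransportW φ (fun _ : Bond d (towerP L m (n + 1)) => (1 : 𝔸ˣ))) (S := adTransportW φ fun _ : Bond d (towerP L m (n + 1)) => (1 : 𝔸ˣ)⁻¹)
        (Δ₁ := hessOp φ η (fun _ : Bond d (towerP L m (n + 1)) => (1 : 𝔸ˣ)) τ) (Rr := RofUk L m n φ η (fun _ : Bond d (towerP L m (n + 1)) => (1 : 𝔸ˣ)))
        (Q := (QkW L m n φ (fun _ : Bond d (towerP L m (n + 1)) => (1 : 𝔸ˣ)) hL (fun _ => 0) (fun _ => by norm_num)
          (perCfg_UlevOf_one_mem_U1 L m (n + 1)) (norm_Wcx_UlevOf_one_sub_one_le L m (n + 1) (fun _ => 0) (fun _ => le_rfl)) (c₀ := c₀) (c₁ := c₁)))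
        (a := a) hpos1 hQ1 x‖ ≤ (C * α) * ‖x‖ := fun x => by rw [mul_assoc]; exact ((HF x).2.2.2.1).trans_eq (by ring)
  have hH : ∀ b : BondL2K ℂ d m c₁ W, ‖H1LatticeK hposU hQU b - H1LatticeK (c := ((η : ℂ))⁻¹)
        (R := adTransportW φ (fun _ : Bond d (towerP L m (n + 1)) => (1 : 𝔸ˣ))) (S := adTransportW φ fun _ : Bond d (towerP L m (n + 1)) => (1 : 𝔸ˣ)⁻¹)
        (Δ₁ := hessOp φ η (fun _ : Bond d (towerP L m (n + 1)) => (1 : 𝔸ˣ)) τ) (Rr := RofUk L m n φ η (fun _ : Bond d (towerP L m (n + 1)) => (1 : 𝔸ˣ)))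
        (Q := (QkW L m n φ (fun _ : Bond d (towerP L m (n + 1)) => (1 : 𝔸ˣ)) hL (fun _ => 0) (fun _ => by norm_num)
          (perCfg_UlevOf_one_mem_U1 L m (n + 1)) (norm_Wcx_UlevOf_one_sub_one_le L m (n + 1) (fun _ => 0) (fun _ => le_rfl)) (c₀ := c₀) (c₁ := c₁)))
        (a := a) hpos1 hQ1 b‖ ≤ (C * α) * ‖b‖ := fun b => by rw [mul_assoc]; exact ((HH b).2.2.2.1).trans_eq (by ring)
  have hCα : 0 ≤ C * α := mul_nonneg hC.le hα0
  have hαη : 0 ≤ α * η := mul_nonneg hα0 (le_of_lt (Fact.out : 0 < η))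
  -- the flat derivative letter and the defect of the derivative letters
  have h1b : ∀ b : Bond d (towerP L m (n + 1)), ‖(((fun _ : Bond d (towerP L m (n + 1)) => (1 : 𝔸ˣ)) b : 𝔸ˣ) : 𝔸)‖ ≤ 1 ∧
      ‖((((fun _ : Bond d (towerP L m (n + 1)) => (1 : 𝔸ˣ)) b)⁻¹ : 𝔸ˣ) : 𝔸)‖ ≤ 1 := fun b =>
    ⟨by rw [Units.val_one, norm_one], by rw [inv_one, Units.val_one, norm_one]⟩
  have hD1 : ∀ g : Bond d (towerP L m (n + 1)) → 𝔸, ‖nabla115 η (fun _ : Bond d (towerP L m (n + 1)) => (1 : 𝔸ˣ)) g‖ ≤ (2 * ‖((η : ℂ))⁻¹‖) * ‖g‖ :=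
    fun g => norm_nabla115_le η _ h1b g
  refine ⟨fun f => ?_, fun f => ?_, fun B => ?_⟩
  · exact norm_jetId_le lev₁ (nabla115 η U) (nabla115 η fun _ => 1) (by positivity) (norm_nabla115_sub_flat_le η U hUb hαη hUη) f
  · have e1 : LinearMap.toContinuousLinearMap
            ((jetLinearEquiv (L : ℝ) η lev₀ lev₁ (nabla115 η (fun _ : Bond d (towerP L m (n + 1)) => (1 : 𝔸ˣ)))).symm.toLinearMap ∘ₗ
              (jetLinearEquiv (L : ℝ) η lev₀ lev₁ (nabla115 η U)).toLinearMap)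
            (frakGLatticeCLM (L := (L : ℝ)) (η := η) (lev₀ := lev₀) φ hposU hQU lev₁ (nabla115 η U) f) =
        toCLM115 (L := (L : ℝ)) (η := η) (lev₀ := lev₀) lev₁ (nabla115 η fun _ : Bond d (towerP L m (n + 1)) => (1 : 𝔸ˣ))
          (readFun φ (fun _ => c₀) (fun _ => c₀) (frakGLatticeK hposU hQU)) f :=
      jetId_frakG_eq_toCLM115_readFun (L := (L : ℝ)) (η := η) (lev₀ := lev₀) φ lev₁ (nabla115 η U) (nabla115 η fun _ => 1)
        (G1LatticeK hposU) (QkW L m n φ U hL αU hα1 hU1 hreg (c₀ := c₀) (c₁ := c₁)) (KinvLatticeK hposU hQU)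
        (covDerivL2K ℂ c₀ ((η : ℂ))⁻¹ (adTransportW φ U)) (RofUk L m n φ η U)
        (covDivL2K ℂ c₀ ((η : ℂ))⁻¹ (adTransportW φ fun b => (U b)⁻¹)) f
    have e2 : frakGLatticeCLM (L := (L : ℝ)) (η := η) (lev₀ := lev₀) (c := ((η : ℂ))⁻¹) (R := adTransportW φ (fun _ : Bond d (towerP L m (n + 1)) => (1 : 𝔸ˣ)))
              (S := adTransportW φ fun _ : Bond d (towerP L m (n + 1)) => (1 : 𝔸ˣ)⁻¹) (Δ₁ := hessOp φ η (fun _ : Bond d (towerP L m (n + 1)) => (1 : 𝔸ˣ)) τ)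
              (Rr := RofUk L m n φ η (fun _ : Bond d (towerP L m (n + 1)) => (1 : 𝔸ˣ)))
              (Q := (QkW L m n φ (fun _ : Bond d (towerP L m (n + 1)) => (1 : 𝔸ˣ)) hL (fun _ => 0) (fun _ => by norm_num)
                (perCfg_UlevOf_one_mem_U1 L m (n + 1)) (norm_Wcx_UlevOf_one_sub_one_le L m (n + 1) (fun _ => 0) (fun _ => le_rfl)) (c₀ := c₀) (c₁ := c₁)))
              (a := a) φ hpos1 hQ1 lev₁ (nabla115 η fun _ : Bond d (towerP L m (n + 1)) => (1 : 𝔸ˣ)) f =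
        toCLM115 (L := (L : ℝ)) (η := η) (lev₀ := lev₀) lev₁ (nabla115 η fun _ : Bond d (towerP L m (n + 1)) => (1 : 𝔸ˣ))
          (readFun φ (fun _ => c₀) (fun _ => c₀) (frakGLatticeK (c := ((η : ℂ))⁻¹)
            (R := adTransportW φ (fun _ : Bond d (towerP L m (n + 1)) => (1 : 𝔸ˣ))) (S := adTransportW φ fun _ : Bond d (towerP L m (n + 1)) => (1 : 𝔸ˣ)⁻¹)
            (Δ₁ := hessOp φ η (fun _ : Bond d (towerP L m (n + 1)) => (1 : 𝔸ˣ)) τ) (Rr := RofUk L m n φ η (fun _ : Bond d (towerP L m (n + 1)) => (1 : 𝔸ˣ)))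
            (Q := (QkW L m n φ (fun _ : Bond d (towerP L m (n + 1)) => (1 : 𝔸ˣ)) hL (fun _ => 0) (fun _ => by norm_num)
              (perCfg_UlevOf_one_mem_U1 L m (n + 1)) (norm_Wcx_UlevOf_one_sub_one_le L m (n + 1) (fun _ => 0) (fun _ => le_rfl)) (c₀ := c₀) (c₁ := c₁)))
            (a := a) hpos1 hQ1)) f :=
      frakG_eq_toCLM115_readFun (L := (L : ℝ)) (η := η) (lev₀ := lev₀) φ lev₁ (nabla115 η fun _ => 1)
        (G1LatticeK hpos1) (QkW L m n φ (fun _ : Bond d (towerP L m (n + 1)) => (1 : 𝔸ˣ)) hL (fun _ => 0) (fun _ => by norm_num)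
          (perCfg_UlevOf_one_mem_U1 L m (n + 1)) (norm_Wcx_UlevOf_one_sub_one_le L m (n + 1) (fun _ => 0) (fun _ => le_rfl)) (c₀ := c₀) (c₁ := c₁))
        (KinvLatticeK hpos1 hQ1) (covDerivL2K ℂ c₀ ((η : ℂ))⁻¹ (adTransportW φ fun _ => 1)) (RofUk L m n φ η fun _ => 1)
        (covDivL2K ℂ c₀ ((η : ℂ))⁻¹ (adTransportW φ fun b => ((fun _ : Bond d (towerP L m (n + 1)) => (1 : 𝔸ˣ)) b)⁻¹)) f
    rw [e1, e2]
    have h := norm_toCLM115_readFun_sub_le (L := (L : ℝ)) (η := η) (lev₀ := lev₀) φ hMφ hφ hMφ' hφ' lev₁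
      (nabla115 η fun _ : Bond d (towerP L m (n + 1)) => (1 : 𝔸ˣ)) (frakGLatticeK hposU hQU)
      (frakGLatticeK (c := ((η : ℂ))⁻¹)
        (R := adTransportW φ (fun _ : Bond d (towerP L m (n + 1)) => (1 : 𝔸ˣ))) (S := adTransportW φ fun _ : Bond d (towerP L m (n + 1)) => (1 : 𝔸ˣ)⁻¹)
        (Δ₁ := hessOp φ η (fun _ : Bond d (towerP L m (n + 1)) => (1 : 𝔸ˣ)) τ) (Rr := RofUk L m n φ η (fun _ : Bond d (towerP L m (n + 1)) => (1 : 𝔸ˣ)))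
        (Q := (QkW L m n φ (fun _ : Bond d (towerP L m (n + 1)) => (1 : 𝔸ˣ)) hL (fun _ => 0) (fun _ => by norm_num)
          (perCfg_UlevOf_one_mem_U1 L m (n + 1)) (norm_Wcx_UlevOf_one_sub_one_le L m (n + 1) (fun _ => 0) (fun _ => le_rfl)) (c₀ := c₀) (c₁ := c₁)))
        (a := a) hpos1 hQ1) hCα hG hD1 f
    exact le_of_le_of_eq h (by ring)
  · have e1 : LinearMap.toContinuousLinearMap
            ((jetLinearEquiv (L : ℝ) η lev₀ lev₁ (nabla115 η (fun _ : Bond d (towerP L m (n + 1)) => (1 : 𝔸ˣ)))).symm.toLinearMap ∘ₗ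
              (jetLinearEquiv (L : ℝ) η lev₀ lev₁ (nabla115 η U)).toLinearMap)
            (H1LatticeCLM (L := (L : ℝ)) (η := η) (lev₀ := lev₀) (levB := levB) φ hposU hQU lev₁ (nabla115 η U) B) =
        H1CLM (L := (L : ℝ)) (η := η) (lev₀ := lev₀) (levB := levB) φ lev₁ (nabla115 η fun _ : Bond d (towerP L m (n + 1)) => (1 : 𝔸ˣ))
          (H1LatticeK hposU hQU) B := rfl
    have e2 : H1LatticeCLM (L := (L : ℝ)) (η := η) (lev₀ := lev₀) (levB := levB) (c := ((η : ℂ))⁻¹)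
              (R := adTransportW φ (fun _ : Bond d (towerP L m (n + 1)) => (1 : 𝔸ˣ)))
              (S := adTransportW φ fun _ : Bond d (towerP L m (n + 1)) => (1 : 𝔸ˣ)⁻¹) (Δ₁ := hessOp φ η (fun _ : Bond d (towerP L m (n + 1)) => (1 : 𝔸ˣ)) τ)
              (Rr := RofUk L m n φ η (fun _ : Bond d (towerP L m (n + 1)) => (1 : 𝔸ˣ)))
              (Q := (QkW L m n φ (fun _ : Bond d (towerP L m (n + 1)) => (1 : 𝔸ˣ)) hL (fun _ => 0) (fun _ => by norm_num)
                (perCfg_UlevOf_one_mem_U1 L m (n + 1)) (norm_Wcx_UlevOf_one_sub_one_le L m (n + 1) (fun _ => 0) (fun _ => le_rfl)) (c₀ := c₀) (c₁ := c₁)))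
              (a := a) φ hpos1 hQ1 lev₁ (nabla115 η fun _ : Bond d (towerP L m (n + 1)) => (1 : 𝔸ˣ)) B =
        H1CLM (L := (L : ℝ)) (η := η) (lev₀ := lev₀) (levB := levB) φ lev₁ (nabla115 η fun _ : Bond d (towerP L m (n + 1)) => (1 : 𝔸ˣ))
          (H1LatticeK (c := ((η : ℂ))⁻¹)
            (R := adTransportW φ (fun _ : Bond d (towerP L m (n + 1)) => (1 : 𝔸ˣ))) (S := adTransportW φ fun _ : Bond d (towerP L m (n + 1)) => (1 : 𝔸ˣ)⁻¹)
            (Δ₁ := hessOp φ η (fun _ : Bond d (towerP L m (n + 1)) => (1 : 𝔸ˣ)) τ) (Rr := RofUk L m n φ η (fun _ : Bond d (towerP L m (n + 1)) => (1 : 𝔸ˣ)))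
            (Q := (QkW L m n φ (fun _ : Bond d (towerP L m (n + 1)) => (1 : 𝔸ˣ)) hL (fun _ => 0) (fun _ => by norm_num)
              (perCfg_UlevOf_one_mem_U1 L m (n + 1)) (norm_Wcx_UlevOf_one_sub_one_le L m (n + 1) (fun _ => 0) (fun _ => le_rfl)) (c₀ := c₀) (c₁ := c₁)))
            (a := a) hpos1 hQ1) B := rfl
    rw [e1, e2]
    have h := norm_H1CLM_sub_le (L := (L : ℝ)) (η := η) (lev₀ := lev₀) (levB := levB) φ hMφ hφ hMφ' hφ' lev₁
      (nabla115 η fun _ : Bond d (towerP L m (n + 1)) => (1 : 𝔸ˣ)) (H1LatticeK hposU hQU)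
      (H1LatticeK (c := ((η : ℂ))⁻¹)
        (R := adTransportW φ (fun _ : Bond d (towerP L m (n + 1)) => (1 : 𝔸ˣ))) (S := adTransportW φ fun _ : Bond d (towerP L m (n + 1)) => (1 : 𝔸ˣ)⁻¹)
        (Δ₁ := hessOp φ η (fun _ : Bond d (towerP L m (n + 1)) => (1 : 𝔸ˣ)) τ) (Rr := RofUk L m n φ η (fun _ : Bond d (towerP L m (n + 1)) => (1 : 𝔸ˣ)))
        (Q := (QkW L m n φ (fun _ : Bond d (towerP L m (n + 1)) => (1 : 𝔸ˣ)) hL (fun _ => 0) (fun _ => by norm_num)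
          (perCfg_UlevOf_one_mem_U1 L m (n + 1)) (norm_Wcx_UlevOf_one_sub_one_le L m (n + 1) (fun _ => 0) (fun _ => le_rfl)) (c₀ := c₀) (c₁ := c₁)))
        (a := a) hpos1 hQ1) hCα hH hD1 B
    exact le_of_le_of_eq h (by ring)

end Literature.MathematicalPhysics.QuantumFieldTheory.Balaban1983to89.B11Eq117LetterDefectsTowerDiagonal

end
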